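import Mathlib

/-!
# Chain normal form of a block word (`stub_chainNormalForm`)

A *letter* `l : Fin 3 × Fin 3 × ℂ × Option σ` encodes the elementary matrix
`Matrix.transvection l.1 l.2.1 (C l.2.2.1 * l.2.2.2.elim 1 X)` over `MvPolynomial σ ℂ`, i.e.
`E_ij(c)` (variable slot `none`, a *constant* letter) or `E_ij(c · x_v)` (variable slot `some v`,
a *variable* letter); the matrix of a word is the product of its letters.

**Chain normal form.**  Telescoping the constant letters of a word with off-diagonal letters
(`i ≠ j`) to the right rewrites its matrix as `(Π_t (1 + x_{v_t} • N_t)) * H` with one factor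
per variable letter, `N_t` a *constant* square-zero `3 × 3` matrix (a conjugate of `c • E_ij`)
and `H` a constant matrix.  If the word computes `E_02(f)`, taking constant coefficients
entrywise gives `H = E_02(f(0))`, whence `Π_t (1 + x_{v_t} • N_t) = E_02(f − f(0))`.
-/

-- `Summit.ValiantsHypothesis.ValiantsHypothesis.…` is the tree's mandated single-conjunct layout.
set_option linter.dupNamespace false

namespace Summit.ValiantsHypothesis.ValiantsHypothesis.Theorems.WordPerSuperQuartic

open MvPolynomial

/-- Functoriality of transvections under an entrywise ring homomorphism. -/
private theorem cnf_transvection_map {m R S : Type*} [DecidableEq m] [Fintype m]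
    [CommRing R] [CommRing S] (f : R →+* S) (i j : m) (c : R) :
    (Matrix.transvection i j c).map f = Matrix.transvection i j (f c) := by
  ext k l
  simp only [Matrix.transvection, Matrix.map_apply, Matrix.add_apply, Matrix.one_apply,
    Matrix.single_apply]
  split_ifs <;> simp

/-- Pushing a constant matrix `g` with left inverse `g'` through one chain factor
`1 + x_v • N`: the factor becomes `1 + x_v • (g N g')`. -/
private theorem cnf_push_factor {σ : Type} (g g' N : Matrix (Fin 3) (Fin 3) ℂ)
    (hg : g' * g = 1) (v : σ) :
    g.map (C : ℂ → MvPolynomial σ ℂ) *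
        ((1 : Matrix (Fin 3) (Fin 3) (MvPolynomial σ ℂ)) +
          (X v : MvPolynomial σ ℂ) • N.map (C : ℂ → MvPolynomial σ ℂ)) =
      ((1 : Matrix (Fin 3) (Fin 3) (MvPolynomial σ ℂ)) +
          (X v : MvPolynomial σ ℂ) • (g * N * g').map (C : ℂ → MvPolynomial σ ℂ)) *
        g.map (C : ℂ → MvPolynomial σ ℂ) := by
  have h : g * N * g' * g = g * N := by rw [Matrix.mul_assoc (g * N), hg, Matrix.mul_one]
  rw [Matrix.mul_add, Matrix.add_mul, Matrix.mul_one, Matrix.one_mul, Matrix.mul_smul,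
    Matrix.smul_mul, ← Matrix.map_mul, ← Matrix.map_mul, h]

/-- Pushing a constant matrix `g` with left inverse `g'` through a whole chain conjugates every
`N_t` by `g`. -/
private theorem cnf_push_chain {σ : Type} (g g' : Matrix (Fin 3) (Fin 3) ℂ) (hg : g' * g = 1)
    (L : List (σ × Matrix (Fin 3) (Fin 3) ℂ)) :
    g.map (C : ℂ → MvPolynomial σ ℂ) *
        (L.map (fun e => (1 : Matrix (Fin 3) (Fin 3) (MvPolynomial σ ℂ)) +
          (X e.1 : MvPolynomial σ ℂ) • e.2.map (C : ℂ → MvPolynomial σ ℂ))).prod =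
      ((L.map (fun e => (e.1, g * e.2 * g'))).map
          (fun e => (1 : Matrix (Fin 3) (Fin 3) (MvPolynomial σ ℂ)) +
            (X e.1 : MvPolynomial σ ℂ) • e.2.map (C : ℂ → MvPolynomial σ ℂ))).prod *
        g.map (C : ℂ → MvPolynomial σ ℂ) := by
  induction L with
  | nil => simp
  | cons e L ih =>
    simp only [List.map_cons, List.prod_cons]
    rw [← Matrix.mul_assoc, cnf_push_factor g g' e.2 hg e.1, Matrix.mul_assoc, ih,
      ← Matrix.mul_assoc _ _ (g.map (C : ℂ → MvPolynomial σ ℂ))]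

/-- **Telescoping.**  A word with off-diagonal letters whose variable letters read only
`p`-variables factors as `(Π_t (1 + x_{v_t} • N_t)) * H` with one pair `(v_t, N_t)` (`p v_t`,
`N_t² = 0`, `N_t` constant) per variable letter and a constant matrix `H`. -/
private theorem cnf_telescope {σ : Type} (p : σ → Prop)
    (w : List (Fin 3 × Fin 3 × ℂ × Option σ))
    (hw : ∀ l ∈ w, l.1 ≠ l.2.1)
    (hv : ∀ l ∈ w, ∀ v, l.2.2.2 = some v → p v) :
    ∃ (L : List (σ × Matrix (Fin 3) (Fin 3) ℂ)) (H : Matrix (Fin 3) (Fin 3) ℂ),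
      L.length = w.countP (fun l => l.2.2.2.isSome) ∧
      (∀ e ∈ L, p e.1) ∧ (∀ e ∈ L, e.2 * e.2 = 0) ∧
      (w.map (fun l => Matrix.transvection l.1 l.2.1 (C l.2.2.1 * l.2.2.2.elim 1 X))).prod =
        (L.map (fun e => (1 : Matrix (Fin 3) (Fin 3) (MvPolynomial σ ℂ)) +
          (X e.1 : MvPolynomial σ ℂ) • e.2.map (C : ℂ → MvPolynomial σ ℂ))).prod *
          H.map (C : ℂ → MvPolynomial σ ℂ) := by
  induction w with
  | nil =>
    refine ⟨[], 1, by simp, by simp, by simp, ?_⟩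
    rw [Matrix.map_one C (map_zero C) (map_one C)]
    simp
  | cons l w ih =>
    obtain ⟨L, H, hlen, hp, hN, hLH⟩ :=
      ih (fun l' hl' => hw l' (List.mem_cons_of_mem _ hl'))
        (fun l' hl' => hv l' (List.mem_cons_of_mem _ hl'))
    obtain ⟨i, j, c, o⟩ := l
    have hij : i ≠ j := hw _ List.mem_cons_self
    cases o with
    | none =>
      -- A constant letter `g = E_ij(c)`: push it through the chain built so far.
      have hg : Matrix.transvection i j (-c) * Matrix.transvection i j c =
          (1 : Matrix (Fin 3) (Fin 3) ℂ) := by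
        rw [Matrix.transvection_mul_transvection_same _ _ hij, neg_add_cancel,
          Matrix.transvection_zero]
      refine ⟨L.map (fun e =>
          (e.1, Matrix.transvection i j c * e.2 * Matrix.transvection i j (-c))),
        Matrix.transvection i j c * H, ?_, ?_, ?_, ?_⟩
      · simpa using hlen
      · intro e he
        obtain ⟨e', he', rfl⟩ := List.mem_map.1 he
        exact hp e' he'
      · intro e he
        obtain ⟨e', he', rfl⟩ := List.mem_map.1 he
        change Matrix.transvection i j c * e'.2 * Matrix.transvection i j (-c) *
            (Matrix.transvection i j c * e'.2 * Matrix.transvection i j (-c)) = 0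
        calc Matrix.transvection i j c * e'.2 * Matrix.transvection i j (-c) *
              (Matrix.transvection i j c * e'.2 * Matrix.transvection i j (-c))
            = Matrix.transvection i j c * e'.2 *
                (Matrix.transvection i j (-c) * Matrix.transvection i j c) * e'.2 *
                  Matrix.transvection i j (-c) := by
              simp only [Matrix.mul_assoc]
          _ = 0 := by
              rw [hg, Matrix.mul_one, Matrix.mul_assoc _ e'.2 e'.2, hN e' he', Matrix.mul_zero,
                Matrix.zero_mul]
      · simp only [List.map_cons, List.prod_cons, Option.elim_none, mul_one]
        rw [← cnf_transvection_map C i j c, hLH, ← Matrix.mul_assoc, cnf_push_chain _ _ hg,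
          Matrix.mul_assoc, ← Matrix.map_mul]
    | some v =>
      -- A variable letter `E_ij(c x_v) = 1 + x_v • (c E_ij)` is itself a chain factor.
      refine ⟨(v, Matrix.single i j c) :: L, H, ?_, ?_, ?_, ?_⟩
      · simpa using hlen
      · intro e he
        rcases List.mem_cons.1 he with rfl | he
        · exact hv _ List.mem_cons_self v rfl
        · exact hp e he
      · intro e he
        rcases List.mem_cons.1 he with rfl | he
        · exact Matrix.single_mul_single_of_ne _ _ _ _ hij.symm _
        · exact hN e he
      · have hletter : Matrix.transvection i j (C c * X v) =
            (1 : Matrix (Fin 3) (Fin 3) (MvPolynomial σ ℂ)) +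
              (X v : MvPolynomial σ ℂ) •
                (Matrix.single i j c).map (C : ℂ → MvPolynomial σ ℂ) := by
          rw [Matrix.transvection, Matrix.map_single, Matrix.smul_single, smul_eq_mul, mul_comm]
        simp only [List.map_cons, List.prod_cons, Option.elim_some]
        rw [hletter, hLH, ← Matrix.mul_assoc]

/-- S1a — **chain normal form**.  A word whose letters are off-diagonal (`i ≠ j`) and whose
variable letters read only `p`-variables, with matrix `E_02(f)`, yields a chain of exactly as many
pairs `(v_t, N_t)` (`p v_t`, `N_t² = 0`, `N_t` a constant `3 × 3` matrix) as the word has variable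
letters, with `Π_t (1 + x_{v_t} • N_t) = E_02(f − f(0))`. -/
theorem stub_chainNormalForm {σ : Type} [DecidableEq σ] (p : σ → Prop) (f : MvPolynomial σ ℂ)
    (w : List (Fin 3 × Fin 3 × ℂ × Option σ))
    (hw : ∀ l ∈ w, l.1 ≠ l.2.1)
    (hv : ∀ l ∈ w, ∀ v, l.2.2.2 = some v → p v)
    (hprod : (w.map (fun l => Matrix.transvection l.1 l.2.1 (C l.2.2.1 * l.2.2.2.elim 1 X))).prod =
      Matrix.transvection (0 : Fin 3) 2 f) :
    ∃ L : List (σ × Matrix (Fin 3) (Fin 3) ℂ),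
      L.length = w.countP (fun l => l.2.2.2.isSome) ∧
      (∀ e ∈ L, p e.1) ∧ (∀ e ∈ L, e.2 * e.2 = 0) ∧
      (L.map (fun e => (1 : Matrix (Fin 3) (Fin 3) (MvPolynomial σ ℂ)) +
        (X e.1 : MvPolynomial σ ℂ) • e.2.map (C : ℂ → MvPolynomial σ ℂ))).prod =
        Matrix.transvection (0 : Fin 3) 2 (f - C (constantCoeff f)) := by
  obtain ⟨L, H, hlen, hp, hN, hLH⟩ := cnf_telescope p w hw hv
  refine ⟨L, hlen, hp, hN, ?_⟩
  rw [hprod] at hLH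
  -- Taking constant coefficients entrywise determines `H = E_02(f(0))`.
  have hH : H = Matrix.transvection 0 2 (constantCoeff f) := by
    have h := congrArg (constantCoeff : MvPolynomial σ ℂ →+* ℂ).mapMatrix hLH
    rw [map_mul, map_list_prod, List.map_map, List.prod_eq_one, one_mul,
      RingHom.mapMatrix_apply, RingHom.mapMatrix_apply, cnf_transvection_map,
      Matrix.map_map] at h
    · rw [h]
      ext a b
      simp
    · intro x hx
      obtain ⟨e, _, rfl⟩ := List.mem_map.1 hx
      rw [Function.comp_apply, map_add, map_one, add_eq_left]
      ext a b
      simp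
  have h02 : (0 : Fin 3) ≠ 2 := by decide
  rw [hH, cnf_transvection_map] at hLH
  calc (L.map (fun e => (1 : Matrix (Fin 3) (Fin 3) (MvPolynomial σ ℂ)) +
          (X e.1 : MvPolynomial σ ℂ) • e.2.map (C : ℂ → MvPolynomial σ ℂ))).prod
      = (L.map (fun e => (1 : Matrix (Fin 3) (Fin 3) (MvPolynomial σ ℂ)) +
          (X e.1 : MvPolynomial σ ℂ) • e.2.map (C : ℂ → MvPolynomial σ ℂ))).prod *
          Matrix.transvection 0 2 (C (constantCoeff f)) *
            Matrix.transvection 0 2 (-C (constantCoeff f)) := by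
        rw [Matrix.mul_assoc, Matrix.transvection_mul_transvection_same _ _ h02, add_neg_cancel,
          Matrix.transvection_zero, Matrix.mul_one]
    _ = Matrix.transvection 0 2 f * Matrix.transvection 0 2 (-C (constantCoeff f)) := by
        rw [← hLH]
    _ = Matrix.transvection (0 : Fin 3) 2 (f - C (constantCoeff f)) := by
        rw [Matrix.transvection_mul_transvection_same _ _ h02, sub_eq_add_neg]

end Summit.ValiantsHypothesis.ValiantsHypothesis.Theorems.WordPerSuperQuartic
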